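import Mathlib
import Literature.NumberTheory.Sieve.Maynard2016Lemma7Positivity
import HarnessLib

/-!
# Maynard 2016, Lemma 7: reduction to one tuple element `h ∈ 𝓗` at a time

Topic `Literature/NumberTheory/Sieve`. J. Maynard, *Large gaps between primes*, Ann. of Math. (2)
183 (2016), 915–933 = arXiv:1408.5110, §6, proof of Lemma 7: after the positivity step (6.22) the
right-hand side is a sum over `h ∈ 𝓗` of the terms `n = p₀ − hq`; the source evaluates ONE such
term ("the main contribution … is `(1+o_k(1)) 𝔖^{(2)}_{m,p₀,h_k} |𝓘_m| J_k^{(1)}(F) J_k^{(2)}(G) /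
(φ(P_w)(log x)^k (log y)^{k−1})`", display (6.31)) and then remarks "We obtain the same estimate
(6.31) with `𝔖^{(2)}_{m,p₀,h_k}` replaced with `𝔖^{(2)}_{m,p₀,h}` for a different `h ∈ 𝓗`", summing
over `h ∈ 𝓗` in (6.32).

PROVED here: the summation over the tuple, `lemma7Pos_of_tuple : Lemma7Tuple → Lemma7Pos`
(linearity: `Σ_i` of the per-`h_i` lower bounds `∝ J_k^{(1),i}` is the lower bound of `Lemma7Pos`
`∝ Σ_i J_k^{(1),i}`, and `Σ_i Σ_q = Σ_q Σ_i`), with the consequences `lemma7Main_of_tuple`,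
`lemma7_of_lemma6_tuple`, `theorem1_of_lemma6_tuple : Lemma6 → Lemma7Tuple → Maynard2016_theorem1`,
`forall_rankinConstant_of_lemma6_tuple`.

`Lemma7Tuple` is a NAMED FACT (`def … : Prop`): the per-`h` estimate = displays (6.23)–(6.31) and
(6.33) of the source for a single `h = h_i ∈ 𝓗` (normalised by the main term `M_{m,q}` of Lemma 6).

## References

* J. Maynard, *Large gaps between primes*, Ann. of Math. (2) 183 (2016), 915–933; arXiv:1408.5110,
  Lemma 7 (proof, displays (6.22)–(6.33)). [Maynard2016LargeGaps]
-/

open Filter Finset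
open scoped Topology

namespace Literature.NumberTheory.Sieve

namespace Maynard2016

/-! ### The named fact: the estimate for a single `h = h_i ∈ 𝓗` -/

/-- **Maynard 2016, proof of Lemma 7, the estimate for one `h = h_i ∈ 𝓗`** (named fact): with
the quantifiers of `Lemma7` (the constant `c` and the threshold in `x` uniform in `i < k`), for
every `i`,
`Σ_{q ∈ [A,B] prime} (Σ_{d_j | p₀+(h_j−h_i)q ∀j} Σ_{e_j | m(p₀+(h_j−h_i)q)−1 ∀j} λ_{d,e})² / M_{m,q}
  ≥ (1 − κ) c (B − A) J_k^{(1),i}(F) J_k^{(2)}(G) / ((log x)|𝓡_m| I_k^{(1)}(F) I_k^{(2)}(G))`,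
the inner term being the divisor sum of (4.1) at `n = p₀ − h_i q` and `M_{m,q} = normMain` the main
term of Lemma 6. Not proved here (displays (6.23)–(6.31), (6.33): classes mod `P_w`, the bound for
`𝔖_{m,q}⁻¹`, `d_k = e_k = 1`, Bombieri–Vinogradov for the primes `q`, evaluation of the complete
sums, `𝔖_m 𝔖^{(2)}_{m,p₀,h} ≫ ∏_{2<p|m}(p−2)/(p−1)`, Lemma 3). [cite: Maynard2016LargeGaps, Lemma 7 (proof, displays (6.23)–(6.33))] -/
def Lemma7Tuple : Prop :=
  ∀ C_U : ℝ, 0 < C_U → ∀ᶠ ε : ℝ in 𝓝[>] 0, ∃ c : ℝ, 0 < c ∧ ∀ k : ℕ, 2 ≤ k →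
    ∀ (J : ℕ) (cj : Fin J → ℝ) (Fd : Fin k → Fin J → ℝ → ℝ) (G : ℝ → ℝ),
      IsSieveData k J cj Fd G → 0 < I1 cj Fd → 0 < I2 k G → ∀ δ : ℝ, 0 < δ → ∀ κ : ℝ, 0 < κ →
        ∀ᶠ x : ℕ in atTop,
          ∀ m : ℕ, 1 ≤ m → Even m → (m : ℝ) < U C_U ε x / (z x * (Real.log (Real.log x)) ^ 2) →
            ∀ A B : ℝ, (x : ℝ) / 2 ≤ A → B ≤ x →
              δ * (Rm C_U ε x m).card * Real.log x ≤ B - A →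
                ∀ p₀ ∈ Rm C_U ε x m,
                  (∀ i : Fin k, (hTuple k x i : ℝ) * x < p₀ ∧
                      (p₀ : ℝ) < U C_U ε x / m - hTuple k x i * x) →
                    ∀ i : Fin k,
                      (1 - κ) * c * ((B - A) * J1 cj Fd i * J2 k G) /
                          (Real.log x * (Rm C_U ε x m).card * I1 cj Fd * I2 k G) ≤
                        ∑ q ∈ intervalPrimes A B,
                          divSum cj Fd G ε x m q (p₀ - hTuple k x i * q) ^ 2 /
                            normMain cj Fd G C_U ε x m q

/-! ### Summation over the tuple -/

/-- **`Lemma7Tuple → Lemma7Pos`** (sum the per-`h` estimates over `h ∈ 𝓗`, display (6.32); PROVED).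
[cite: Maynard2016LargeGaps, Lemma 7 (proof, display (6.32))] -/
theorem lemma7Pos_of_tuple (h : Lemma7Tuple) : Lemma7Pos := by
  intro C_U hCU
  filter_upwards [h C_U hCU] with ε hε
  obtain ⟨c, hc, hPc⟩ := hε
  refine ⟨c, hc, ?_⟩
  intro k hk J cj Fd G hD hI1 hI2 δ hδ κ hκ
  filter_upwards [hPc k hk J cj Fd G hD hI1 hI2 δ hδ κ hκ] with x hPx
  intro m hm1 hme hmU A B hA hB hAB p₀ hp₀ hp₀'
  have hT := hPx m hm1 hme hmU A B hA hB hAB p₀ hp₀ hp₀'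
  have h1 := Finset.sum_le_sum fun i (_ : i ∈ (Finset.univ : Finset (Fin k))) => hT i
  have hL : ∑ i : Fin k, (1 - κ) * c * ((B - A) * J1 cj Fd i * J2 k G) /
        (Real.log x * (Rm C_U ε x m).card * I1 cj Fd * I2 k G) =
      (1 - κ) * c * ((B - A) * (∑ i, J1 cj Fd i) * J2 k G) /
        (Real.log x * (Rm C_U ε x m).card * I1 cj Fd * I2 k G) := by
    rw [Finset.mul_sum, Finset.sum_mul, Finset.mul_sum, Finset.sum_div]
  have hR : ∑ i : Fin k, ∑ q ∈ intervalPrimes A B,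
        divSum cj Fd G ε x m q (p₀ - hTuple k x i * q) ^ 2 / normMain cj Fd G C_U ε x m q =
      ∑ q ∈ intervalPrimes A B, (∑ i : Fin k, divSum cj Fd G ε x m q (p₀ - hTuple k x i * q) ^ 2) /
        normMain cj Fd G C_U ε x m q := by
    rw [Finset.sum_comm]
    simp_rw [Finset.sum_div]
  rw [← hL, ← hR]
  exact h1

/-! ### Consequences -/

/-- `Lemma7Main` from `Lemma7Tuple`. [cite: Maynard2016LargeGaps, Lemma 7 (proof)] -/
theorem lemma7Main_of_tuple (h : Lemma7Tuple) : Lemma7Main :=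
  lemma7Main_of_pos (lemma7Pos_of_tuple h)

/-- Lemma 7 from Lemma 6 and `Lemma7Tuple`. [cite: Maynard2016LargeGaps, Lemma 7] -/
theorem lemma7_of_lemma6_tuple (h6 : Lemma6) (h7 : Lemma7Tuple) : Lemma7 :=
  lemma7_of_lemma6_pos h6 (lemma7Pos_of_tuple h7)

/-- **Maynard's Theorem 1 from Lemma 6 and `Lemma7Tuple`.** [cite: Maynard2016LargeGaps, Theorem 1] -/
theorem theorem1_of_lemma6_tuple (h6 : Lemma6) (h7 : Lemma7Tuple) :
    Literature.NumberTheory.Sieve.Maynard2016_theorem1 :=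
  theorem1_of_lemma6_pos h6 (lemma7Pos_of_tuple h7)

/-- **`∀ c, RankinConstant c` from Lemma 6 and `Lemma7Tuple`.** [cite: Maynard2016LargeGaps, Theorem 1] -/
theorem forall_rankinConstant_of_lemma6_tuple (h6 : Lemma6) (h7 : Lemma7Tuple) (c : ℝ) :
    Literature.NumberTheory.Sieve.RankinConstant c :=
  forall_rankinConstant_of_lemma6_pos h6 (lemma7Pos_of_tuple h7) c

end Maynard2016

end Literature.NumberTheory.Sieve
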